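import Literature.Analysis.FluidPDE.HomogeneousEulerAxisymmetricZonalRigidity
import Literature.Analysis.FluidPDE.HomogeneousEulerAxisymmetricWindow
import Literature.Analysis.FluidPDE.HomogeneousEulerAxisymmetric
import Literature.Analysis.FluidPDE.AxisymmetricVorticityTransport
import Mathlib.Analysis.Calculus.ContDiff.Deriv
import Mathlib.Analysis.Normed.Module.Connected
import HarnessLib

/-!
# Proof of Shvydkoy 2018, Proposition 5.1: no `C²` axisymmetric homogeneous stationary Euler
# flows of degree `-α`, `0 < α < 2` (discharge of `shvydkoy2018_prop51_noAxisymmetric`)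

R. Shvydkoy, *Homogeneous solutions to the 3D Euler system*, Trans. Amer. Math. Soc. 370 (2018)
2517–2535 = arXiv:1510.03378 [`Shvydkoy2018`], Proposition 5.1 (arXiv p. 11): "There are no
`C²` axisymmetric solutions in the range `0 < α < 2`."  This file discharges the tree's named fact
`Literature.Analysis.FluidPDE.shvydkoy2018_prop51_noAxisymmetric`
(`HomogeneousEulerAxisymmetric.lean`) by proving `shvydkoy2018_prop51_noAxisymmetric_holds`.

The printed proof has two halves: (I) the axisymmetric conservation laws force the spherical
Bernoulli function `H` to vanish ("We have proved that `H = 0` on the entire sphere"); (II) "By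
Proposition 3.2 such solutions are irrotational and `α` is an integer, which excludes solutions
in the given range".  In the tree:

* (I) and the WINDOW `1 < α < 2` of (II) (where Prop. 3.2 is one integration by parts) are
  `HomogeneousEulerAxisymmetricWindow.lean` (seat ns-typeII-lit-1):
  `IsHomogeneousSteadyEuler.bernoulliFn_eq_zero_of_isAxisymmetric` (`H ≡ 0`, all
  `α ∈ (0,2) ∖ {1}`), the public meridian calculus `IsHomogeneousSteadyEuler.meridian_*`
  (Shvydkoy (45)–(48), (50) and the pole conditions for the profile functions of the polar
  angle), and `shvydkoy2018_prop51_noAxisymmetric_of_one_lt`;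
* `α = 1` is Prop. 2.1, `shvydkoy_homogeneousSteadyEuler_alpha_one_holds`
  (`HomogeneousEulerProofs.lean`; no axisymmetry needed);
* the LOWER RANGE `0 < α < 1` of (II) — Prop. 3.2's hard case (the vorticity identity
  `div(f ωⁿ v) = …`) followed by Prop. 3.1 (the Laplace–Beltrami spectrum) — is, for axisymmetric
  data, the zonal ODE rigidity `Shvydkoy2018.zonal_rigidity_of_bernoulli_zero`
  (`HomogeneousEulerAxisymmetricZonalRigidity.lean`) resting on the zonal spectral gap
  `Shvydkoy2018.zonal_eigenfunction_eq_zero` (`HomogeneousEulerZonalSpectralGap.lean`).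

## Contents

* `Shvydkoy2018.zonal_rigidity_of_reduced_system` — the zonal rigidity for `0 < α < 1` with
  Shvydkoy's general-degree reduced system (45)–(48) plus `H = a² + b² + f² + 2p ≡ 0` as
  hypotheses (the `H ≡ 0`-specialised relations of `zonal_rigidity_of_bernoulli_zero` are derived:
  `(46) - α·H`, `(47) + sin φ·H'`);
* `IsHomogeneousSteadyEuler.eq_zero_of_isAxisymmetric_of_lt_one` — Prop. 5.1 for `0 < α < 1`
  (`C²`, bulk form): `H ≡ 0` and the meridian system from the window file, zonal rigidity along
  the meridian `θ = 0`, then `V ≡ 0` off the origin by axisymmetry and homogeneity;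
* `shvydkoy2018_prop51_noAxisymmetric_holds` — the named fact, by cases `α < 1`, `α = 1`, `α > 1`;
  `shvydkoy2018_prop51_noAxisymmetric_holds.eq_zero` — velocity AND pressure vanish.

WHAT THIS IS NOT: not a statement about Navier–Stokes; a Liouville theorem for MODEL objects
(homogeneous stationary Euler pairs), consumed conditionally so far by
`Summit.…PowerGaugeEulerLiouville.HomogeneousTail.selfSimilar_ae_eq_zero_of_axisymmetric_homogeneous_tail`
(crux `EulerZoomLiouville.PowerGaugeEulerLiouville`, stmt-NavierStokesRegularity-19832, window
`α = 1 + ρ ∈ (1, 3/2)`) and by `shvydkoy2018_prop51_noAxisymmetric.twoThirds` (route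
`AnomalousDissipation/PointSink`, stmt-AnomalousDissipation-19033, `α = 2/3`).

## References

* R. Shvydkoy, Trans. Amer. Math. Soc. 370 (2018) 2517–2535, doi:10.1090/tran/7022 =
  arXiv:1510.03378: Props. 2.1, 3.1, 3.2, 5.1, §5 (45)–(51). [`Shvydkoy2018`]
-/

noncomputable section

open Set Filter
open scoped Topology ContDiff InnerProductSpace RealInnerProductSpace

namespace Literature.Analysis.FluidPDE

namespace Shvydkoy2018

/-- Unbundling a `C²` function of one real variable: `g' = deriv g`, `g'' = deriv g'` exist
everywhere and `g''` is continuous. [folklore] -/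
private theorem derivs_of_contDiff_two {g : ℝ → ℝ} (hg : ContDiff ℝ 2 g) :
    (∀ x, HasDerivAt g (deriv g x) x) ∧ (∀ x, HasDerivAt (deriv g) (deriv (deriv g) x) x) ∧
      Continuous (deriv (deriv g)) := by
  have h2 : ContDiff ℝ ((1 : WithTop ℕ∞) + 1) g := by
    rw [show ((1 : WithTop ℕ∞) + 1) = 2 by norm_num]; exact hg
  rw [contDiff_succ_iff_deriv] at h2
  obtain ⟨hd, -, h1⟩ := h2
  have h1' : ContDiff ℝ ((0 : WithTop ℕ∞) + 1) (deriv g) := by rw [zero_add]; exact h1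
  rw [contDiff_succ_iff_deriv] at h1'
  obtain ⟨hd', -, h0⟩ := h1'
  exact ⟨fun x => (hd x).hasDerivAt, fun x => (hd' x).hasDerivAt, h0.continuous⟩

/-- **Shvydkoy 2018, Prop. 3.2 (case `α < 1`), axisymmetric, from the general reduced system.**
The zonal rigidity `zonal_rigidity_of_bernoulli_zero` with its four `H ≡ 0` relations replaced by
Shvydkoy's general-degree axisymmetric system (5.1)–(5.4) (multiplied by `sin φ`) together with
`H = a² + b² + f² + 2p ≡ 0` on `(0,π)`: for `0 < α < 1` such profile functions vanish on `[0, π]`.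
[cite: Shvydkoy2018, Prop. 3.2] -/
theorem zonal_rigidity_of_reduced_system {α : ℝ} (hα0 : 0 < α) (hα1 : α < 1)
    {a a' b b' b'' f f' f'' p p' : ℝ → ℝ}
    (ha : ∀ x, HasDerivAt a (a' x) x) (hb : ∀ x, HasDerivAt b (b' x) x)
    (hb' : ∀ x, HasDerivAt b' (b'' x) x)
    (hf : ∀ x, HasDerivAt f (f' x) x) (hf' : ∀ x, HasDerivAt f' (f'' x) x)
    (hf''c : Continuous f'') (hp : ∀ x, HasDerivAt p (p' x) x)
    (h45 : ∀ φ ∈ Ioo 0 Real.pi,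
      a' φ * Real.sin φ + a φ * Real.cos φ + (2 - α) * f φ * Real.sin φ = 0)
    (h46 : ∀ φ ∈ Ioo 0 Real.pi,
      (a φ * f' φ - a φ ^ 2 - b φ ^ 2 - α * f φ ^ 2 - 2 * α * p φ) * Real.sin φ = 0)
    (h47 : ∀ φ ∈ Ioo 0 Real.pi,
      (a φ * a' φ + (1 - α) * f φ * a φ + p' φ) * Real.sin φ - b φ ^ 2 * Real.cos φ = 0)
    (h48 : ∀ φ ∈ Ioo 0 Real.pi,
      (a φ * b' φ + (1 - α) * f φ * b φ) * Real.sin φ + a φ * b φ * Real.cos φ = 0)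
    (hH : ∀ φ ∈ Ioo 0 Real.pi, a φ ^ 2 + b φ ^ 2 + f φ ^ 2 + 2 * p φ = 0)
    (hb0 : b 0 = 0) (hbπ : b Real.pi = 0) (hf'0 : f' 0 = 0) (hf'π : f' Real.pi = 0) :
    ∀ φ ∈ Icc 0 Real.pi, a φ = 0 ∧ b φ = 0 ∧ f φ = 0 := by
  have hsin : ∀ φ ∈ Ioo 0 Real.pi, 0 < Real.sin φ := fun φ hφ =>
    Real.sin_pos_of_pos_of_lt_pi hφ.1 hφ.2
  -- differentiate `H ≡ 0` on the open interval: `a a' + b b' + f f' + p' = 0`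
  have hH' : ∀ φ ∈ Ioo 0 Real.pi, a φ * a' φ + b φ * b' φ + f φ * f' φ + p' φ = 0 := by
    intro φ hφ
    have hD : HasDerivAt (fun y => a y ^ 2 + b y ^ 2 + f y ^ 2 + 2 * p y)
        (2 * a φ * a' φ + 2 * b φ * b' φ + 2 * f φ * f' φ + 2 * p' φ) φ := by
      have e := ((((ha φ).pow 2).add ((hb φ).pow 2)).add ((hf φ).pow 2)).add ((hp φ).const_mul 2)
      refine e.congr_deriv ?_
      simp only [Nat.reduceSub, pow_one, Nat.cast_ofNat]
    have hev : (fun y => a y ^ 2 + b y ^ 2 + f y ^ 2 + 2 * p y) =ᶠ[𝓝 φ] fun _ => (0 : ℝ) := by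
      filter_upwards [isOpen_Ioo.mem_nhds hφ] with y hy
      exact hH y hy
    have h0 : 2 * a φ * a' φ + 2 * b φ * b' φ + 2 * f φ * f' φ + 2 * p' φ = 0 :=
      hD.unique ((hasDerivAt_const φ (0 : ℝ)).congr_of_eventuallyEq hev)
    linarith
  refine zonal_rigidity_of_bernoulli_zero hα0 hα1 ha hb hb' hf hf' hf''c ?_ ?_ ?_ ?_ hb0 hbπ
    hf'0 hf'π
  · intro φ hφ
    linear_combination h45 φ hφ
  · intro φ hφ
    have hs := (hsin φ hφ).ne'
    have e46 : a φ * f' φ - a φ ^ 2 - b φ ^ 2 - α * f φ ^ 2 - 2 * α * p φ = 0 :=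
      (mul_eq_zero.mp (h46 φ hφ)).resolve_right hs
    linear_combination e46 + α * hH φ hφ
  · intro φ hφ
    linear_combination -(h47 φ hφ) + Real.sin φ * hH' φ hφ
  · intro φ hφ
    linear_combination h48 φ hφ

end Shvydkoy2018

/-! ### Prop. 5.1 for `0 < α < 1` -/

namespace IsHomogeneousSteadyEuler

variable {α : ℝ} {V : EuclideanSpace ℝ (Fin 3) → EuclideanSpace ℝ (Fin 3)}
  {P : EuclideanSpace ℝ (Fin 3) → ℝ}

/-- The meridian point `(sin φ, 0, cos φ)` is non-zero. [folklore] -/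
private theorem meridian_point_ne_zero (φ : ℝ) :
    Real.sin φ • EuclideanSpace.single (0 : Fin 3) (1 : ℝ) +
      Real.cos φ • EuclideanSpace.single (2 : Fin 3) (1 : ℝ) ≠ 0 := by
  intro h0
  have e0 := congrArg (fun w : EuclideanSpace ℝ (Fin 3) => w 0) h0
  have e2 := congrArg (fun w : EuclideanSpace ℝ (Fin 3) => w 2) h0
  simp at e0 e2
  have h1 := Real.sin_sq_add_cos_sq φ
  rw [e0, e2] at h1
  norm_num at h1

/-- **Shvydkoy 2018, Prop. 5.1, lower range `0 < α < 1` (bulk form).** A homogeneous stationary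
Euler pair of degree `-α`, `0 < α < 1`, on `ℝ³ ∖ {0}` which is `C²` off the origin and axisymmetric
(velocity equivariant, pressure invariant under the rotations about the `x₂`-axis) has `V ≡ 0` off
the origin: `H ≡ 0` (conservation laws), then Prop. 3.2 (`α < 1`) and Prop. 3.1 along the meridian
in zonal form, then axisymmetry and homogeneity. [cite: Shvydkoy2018, Prop. 5.1] -/
theorem eq_zero_of_isAxisymmetric_of_lt_one (h : IsHomogeneousSteadyEuler α V P)
    (hV2 : ContDiffOn ℝ 2 V {x | x ≠ 0}) (hP2 : ContDiffOn ℝ 2 P {x | x ≠ 0})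
    (hax : IsAxisymmetric V) (haxP : IsAxisymmetricScalar P) (h0 : 0 < α) (h1 : α < 1)
    ⦃x : EuclideanSpace ℝ (Fin 3)⦄ (hx : x ≠ 0) : V x = 0 := by
  -- the meridian, its frame and the profile functions
  set s : ℝ → EuclideanSpace ℝ (Fin 3) := fun φ => Real.sin φ • EuclideanSpace.single 0 (1 : ℝ) +
    Real.cos φ • EuclideanSpace.single 2 (1 : ℝ) with hs_def
  set e : ℝ → EuclideanSpace ℝ (Fin 3) := fun φ => Real.cos φ • EuclideanSpace.single 0 (1 : ℝ) -
    Real.sin φ • EuclideanSpace.single 2 (1 : ℝ) with he_def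
  set a : ℝ → ℝ := fun ψ => ⟪V (s ψ), e ψ⟫ with ha_def
  set b : ℝ → ℝ := fun ψ => V (s ψ) 1 with hb_def
  set f : ℝ → ℝ := fun ψ => ⟪V (s ψ), s ψ⟫ with hf_def
  set p : ℝ → ℝ := fun ψ => P (s ψ) with hp_def
  set H : ℝ → ℝ := fun ψ => ‖V (s ψ)‖ ^ 2 + 2 * P (s ψ) with hH_def
  have hs : ∀ φ, s φ = Real.sin φ • EuclideanSpace.single 0 (1 : ℝ) +
      Real.cos φ • EuclideanSpace.single 2 (1 : ℝ) := fun _ => rfl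
  have he : ∀ φ, e φ = Real.cos φ • EuclideanSpace.single 0 (1 : ℝ) -
      Real.sin φ • EuclideanSpace.single 2 (1 : ℝ) := fun _ => rfl
  have ha : ∀ ψ, a ψ = ⟪V (s ψ), e ψ⟫ := fun _ => rfl
  have hb : ∀ ψ, b ψ = V (s ψ) 1 := fun _ => rfl
  have hf : ∀ ψ, f ψ = ⟪V (s ψ), s ψ⟫ := fun _ => rfl
  have hp : ∀ ψ, p ψ = P (s ψ) := fun _ => rfl
  have hH : ∀ ψ, H ψ = ‖V (s ψ)‖ ^ 2 + 2 * P (s ψ) := fun _ => rfl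
  -- `C²` profile functions
  obtain ⟨-, haC, hbC, hfC, hpC, -⟩ := meridian_contDiff hV2 hP2 hs he ha hb hf hp hH
  obtain ⟨ha1, -, -⟩ := Shvydkoy2018.derivs_of_contDiff_two haC
  obtain ⟨hb1, hb2, -⟩ := Shvydkoy2018.derivs_of_contDiff_two hbC
  obtain ⟨hf1, hf2, hf3⟩ := Shvydkoy2018.derivs_of_contDiff_two hfC
  obtain ⟨hp1, -, -⟩ := Shvydkoy2018.derivs_of_contDiff_two hpC
  -- `H ≡ 0` along the meridian (half (I) of the printed proof)
  have hHz : ∀ φ ∈ Ioo 0 Real.pi, a φ ^ 2 + b φ ^ 2 + f φ ^ 2 + 2 * p φ = 0 := by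
    intro φ _
    have hq := h.bernoulliFn_eq_zero_of_isAxisymmetric hax haxP h0 h1.ne (by linarith)
      (meridian_point_ne_zero φ)
    rw [← meridian_bernoulli_eq hs he ha hb hf hp hH φ]
    exact hq
  -- the reduced system and the pole conditions
  have h45 : ∀ φ ∈ Ioo 0 Real.pi,
      deriv a φ * Real.sin φ + a φ * Real.cos φ + (2 - α) * f φ * Real.sin φ = 0 :=
    fun φ _ => h.meridian_div hax hs he ha hf φ
  have hmom := fun φ => h.meridian_momentum hax haxP hs he ha hb hf hp φ
  obtain ⟨-, -, hb0, hbπ, hf'0, hf'π⟩ := h.meridian_poles hax hs he ha hb hf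
  have hzero := Shvydkoy2018.zonal_rigidity_of_reduced_system h0 h1 ha1 hb1 hb2 hf1 hf2 hf3 hp1
    h45 (fun φ _ => by linear_combination (hmom φ).1) (fun φ _ => (hmom φ).2.1)
    (fun φ _ => (hmom φ).2.2) hHz hb0 hbπ hf'0 hf'π
  -- the velocity vanishes on the closed meridian, hence everywhere
  have hVs0 : ∀ φ ∈ Icc 0 Real.pi, V (s φ) = 0 := by
    intro φ hφ
    obtain ⟨ha0, hb0', hf0⟩ := hzero φ hφ
    rw [(meridian_velocity_eq hs he ha hb hf φ).1, ha0, hb0', hf0, zero_smul, zero_smul,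
      zero_smul, add_zero, add_zero]
  exact h.eq_zero_of_meridian_velocity_eq_zero hax hs hVs0 hx

end IsHomogeneousSteadyEuler

/-! ### The named fact -/

/-- **Discharge of Shvydkoy 2018, Prop. 5.1** (`shvydkoy2018_prop51_noAxisymmetric`): there is no
non-trivial `C²` axisymmetric homogeneous stationary Euler flow on `ℝ³ ∖ {0}` of degree `-α`,
`0 < α < 2`.  Cases: `α < 1` (`eq_zero_of_isAxisymmetric_of_lt_one`: conservation laws, the
vorticity identity of Prop. 3.2 and the spectral gap of Prop. 3.1, zonally), `α = 1` (Prop. 2.1,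
`shvydkoy_homogeneousSteadyEuler_alpha_one_holds`), `1 < α < 2`
(`shvydkoy2018_prop51_noAxisymmetric_of_one_lt`: conservation laws and the Bernoulli integration by
parts of Prop. 3.2). [cite: Shvydkoy2018, Prop. 5.1] -/
theorem shvydkoy2018_prop51_noAxisymmetric_holds : shvydkoy2018_prop51_noAxisymmetric := by
  intro α h0 h2 V P h hV2 hP2 hax haxP x hx
  rcases lt_trichotomy α 1 with h1 | rfl | h1
  · exact h.eq_zero_of_isAxisymmetric_of_lt_one hV2 hP2 hax haxP h0 h1 hx
  · exact shvydkoy_homogeneousSteadyEuler_alpha_one_holds h hx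
  · exact shvydkoy2018_prop51_noAxisymmetric_of_one_lt h1 h2 h hV2 hP2 hax haxP x hx

/-- **Shvydkoy 2018, Prop. 5.1, with the pressure**: under the hypotheses of the fact both the
velocity and the pressure vanish off the origin (`α ≠ 0`, Euler's relation for `P`).
[cite: Shvydkoy2018, Prop. 5.1] -/
theorem shvydkoy2018_prop51_noAxisymmetric_holds.eq_zero {α : ℝ} (h0 : 0 < α) (h2 : α < 2)
    {V : EuclideanSpace ℝ (Fin 3) → EuclideanSpace ℝ (Fin 3)} {P : EuclideanSpace ℝ (Fin 3) → ℝ}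
    (h : IsHomogeneousSteadyEuler α V P)
    (hV2 : ContDiffOn ℝ 2 V {x | x ≠ 0}) (hP2 : ContDiffOn ℝ 2 P {x | x ≠ 0})
    (hax : IsAxisymmetric V) (haxP : IsAxisymmetricScalar P) :
    (∀ x, x ≠ 0 → V x = 0) ∧ ∀ x, x ≠ 0 → P x = 0 := by
  have hV : ∀ x, x ≠ 0 → V x = 0 :=
    shvydkoy2018_prop51_noAxisymmetric_holds h0 h2 h hV2 hP2 hax haxP
  exact ⟨hV, fun x hx => h.pressure_eq_zero_of_velocity_eq_zero h0.ne' (fun y hy => hV y hy) hx⟩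

/-! ### Appendix (ns-typeII-p1 g5, same session): the symmetry hypothesis on the pressure is automatic -/

namespace IsHomogeneousSteadyEuler

variable {α : ℝ} {V : EuclideanSpace ℝ (Fin 3) → EuclideanSpace ℝ (Fin 3)}
  {P : EuclideanSpace ℝ (Fin 3) → ℝ}

/-- Rotations about the axis map non-zero vectors to non-zero vectors. [folklore] -/
private theorem rotZ_ne_zero' (θ : ℝ) {x : EuclideanSpace ℝ (Fin 3)} (hx : x ≠ 0) :
    rotZ θ x ≠ 0 := by
  intro h0
  apply hx
  have h1 := congrArg (fun w : EuclideanSpace ℝ (Fin 3) => ‖w‖) h0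
  simp only [norm_rotZ, norm_zero] at h1
  exact norm_eq_zero.mp h1

/-- **The pressure of an axisymmetric homogeneous stationary Euler flow is an axisymmetric
scalar** (so the hypothesis `IsAxisymmetricScalar P` of Prop. 5.1 / of the fact
`shvydkoy2018_prop51_noAxisymmetric` is implied by the others when `α ≠ 0`): for every rotation
`R` about the axis, `(V∘R, P∘R) = (R∘V, P∘R)` solves the same momentum equation, whence
`∇(P∘R) = ∇P` off the origin; `ℝ³ ∖ {0}` is connected, so `P∘R − P` is a constant, which is
homogeneous of degree `-2α ≠ 0`, hence zero (Shvydkoy's axisymmetric ansatz takes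
`p = p(φ)`, §5). [cite: Shvydkoy2018, §5 (the axisymmetric ansatz)] -/
theorem isAxisymmetricScalar_pressure (h : IsHomogeneousSteadyEuler α V P)
    (hax : IsAxisymmetric V) (hα : α ≠ 0) : IsAxisymmetricScalar P := by
  intro θ x
  rcases eq_or_ne x 0 with rfl | hx
  · have h0 : rotZ θ (0 : EuclideanSpace ℝ (Fin 3)) = 0 := by
      ext i
      fin_cases i <;> simp [rotZ]
    rw [h0]
  set R : EuclideanSpace ℝ (Fin 3) →L[ℝ] EuclideanSpace ℝ (Fin 3) := rotZL θ with hR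
  have hRap : ∀ y, R y = rotZ θ y := fun y => rfl
  -- the momentum equation in inner form
  have hmom : ∀ {z : EuclideanSpace ℝ (Fin 3)}, z ≠ 0 → ∀ w,
      fderiv ℝ P z w = -⟪fderiv ℝ V z (V z), w⟫ := by
    intro z hz w
    have hm := h.momentum hz
    rw [convect_apply, add_eq_zero_iff_eq_neg] at hm
    rw [← Shvydkoy2018.inner_gradient_left, hm, inner_neg_left, neg_neg]
  -- equivariance of the Jacobian: `DV(R y)(R w) = R (DV(y) w)` off the origin
  have hDV : ∀ {y : EuclideanSpace ℝ (Fin 3)}, y ≠ 0 → ∀ w,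
      fderiv ℝ V (rotZ θ y) (rotZ θ w) = rotZ θ (fderiv ℝ V y w) := by
    intro y hy w
    have hl : HasFDerivAt (fun z => V (R z)) ((fderiv ℝ V (R y)).comp R) y :=
      (h.differentiableAt_velocity (rotZ_ne_zero' θ hy)).hasFDerivAt.comp y R.hasFDerivAt
    have hr : HasFDerivAt (fun z => R (V z)) (R.comp (fderiv ℝ V y)) y :=
      R.hasFDerivAt.comp y (h.differentiableAt_velocity hy).hasFDerivAt
    have hcomp : (fun z => V (R z)) = fun z => R (V z) := funext fun z => hax θ z
    rw [hcomp] at hl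
    have heq := congrArg (fun L : EuclideanSpace ℝ (Fin 3) →L[ℝ] EuclideanSpace ℝ (Fin 3) => L w)
      (hl.unique hr)
    simpa only [ContinuousLinearMap.comp_apply, hRap] using heq
  -- hence `DP(R y)(R w) = DP(y) w`
  have hDP : ∀ {y : EuclideanSpace ℝ (Fin 3)}, y ≠ 0 → ∀ w,
      fderiv ℝ P (rotZ θ y) (rotZ θ w) = fderiv ℝ P y w := by
    intro y hy w
    rw [hmom (rotZ_ne_zero' θ hy), hmom hy, hax θ y, hDV hy (V y)]
    have hinner := (rotZLIE θ).inner_map_map (fderiv ℝ V y (V y)) w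
    simp only [rotZLIE_apply] at hinner
    rw [hinner]
  -- `D = P∘R − P` has zero derivative on the connected open set `ℝ³ ∖ {0}`
  set s : Set (EuclideanSpace ℝ (Fin 3)) := {y | y ≠ 0} with hs_def
  have hDd : DifferentiableOn ℝ (fun y => P (R y) - P y) s := fun y hy =>
    (((h.differentiableAt_pressure (rotZ_ne_zero' θ hy)).comp y R.differentiableAt).sub
      (h.differentiableAt_pressure hy)).differentiableWithinAt
  have hD0 : s.EqOn (fderiv ℝ (fun y => P (R y) - P y)) 0 := by
    intro y hy
    have h1 : HasFDerivAt (fun z => P (R z)) ((fderiv ℝ P (R y)).comp R) y :=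
      (h.differentiableAt_pressure (rotZ_ne_zero' θ hy)).hasFDerivAt.comp y R.hasFDerivAt
    have h2 : HasFDerivAt P (fderiv ℝ P y) y := (h.differentiableAt_pressure hy).hasFDerivAt
    have h3 : HasFDerivAt (fun z => P (R z) - P z) (((fderiv ℝ P (R y)).comp R) - fderiv ℝ P y) y :=
      h1.sub h2
    rw [h3.fderiv]
    ext w
    simp only [sub_apply, ContinuousLinearMap.comp_apply, hRap, Pi.zero_apply, zero_apply,
      hDP hy w, sub_self]
  have hso : IsOpen s := isOpen_ne
  have hsc : IsPreconnected s := by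
    have hrank : 1 < Module.rank ℝ (EuclideanSpace ℝ (Fin 3)) := by
      rw [← Module.finrank_eq_rank, finrank_euclideanSpace_fin]
      exact_mod_cast (by norm_num : (1 : ℕ) < 3)
    have hseq : s = ({(0 : EuclideanSpace ℝ (Fin 3))} : Set (EuclideanSpace ℝ (Fin 3)))ᶜ := by
      ext y; simp [hs_def]
    rw [hseq]
    exact (isConnected_compl_singleton_of_one_lt_rank hrank 0).isPreconnected
  have h2x : (2 : ℝ) • x ≠ 0 := smul_ne_zero two_ne_zero hx
  have hconst := hso.is_const_of_fderiv_eq_zero hsc hDd hD0 hx h2x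
  -- homogeneity: `D(2x) = 2^{-2α} D(x)`
  have hscale : P (R ((2 : ℝ) • x)) - P ((2 : ℝ) • x) = (2 : ℝ) ^ (-(2 * α)) * (P (R x) - P x) := by
    rw [map_smul, hRap, h.pressure_smul two_pos (rotZ_ne_zero' θ hx), h.pressure_smul two_pos hx]
    ring
  have hne : (2 : ℝ) ^ (-(2 * α)) ≠ 1 := by
    rcases lt_or_gt_of_ne hα with hneg | hpos
    · exact (Real.one_lt_rpow (by norm_num) (by linarith)).ne'
    · exact (Real.rpow_lt_one_of_one_lt_of_neg (by norm_num) (by linarith)).ne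
  have hzero : P (R x) - P x = 0 := by
    have hfin : (1 - (2 : ℝ) ^ (-(2 * α))) * (P (R x) - P x) = 0 := by
      have := hconst.trans hscale
      linear_combination this
    exact (mul_eq_zero.mp hfin).resolve_left (sub_ne_zero.mpr hne.symm)
  rw [hRap] at hzero
  linarith

/-- **Shvydkoy 2018, Prop. 5.1 with only the velocity assumed axisymmetric** (`C²`, `0 < α < 2`):
the pressure symmetry is automatic (`isAxisymmetricScalar_pressure`). [cite: Shvydkoy2018, Prop. 5.1] -/
theorem eq_zero_of_isAxisymmetric_velocity (h : IsHomogeneousSteadyEuler α V P)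
    (hV2 : ContDiffOn ℝ 2 V {x | x ≠ 0}) (hP2 : ContDiffOn ℝ 2 P {x | x ≠ 0})
    (hax : IsAxisymmetric V) (h0 : 0 < α) (h2 : α < 2)
    ⦃x : EuclideanSpace ℝ (Fin 3)⦄ (hx : x ≠ 0) : V x = 0 :=
  shvydkoy2018_prop51_noAxisymmetric_holds h0 h2 h hV2 hP2 hax
    (h.isAxisymmetricScalar_pressure hax h0.ne') x hx

/-- **The window `1 < α < 2` in the `C¹` class with only the velocity assumed axisymmetric**
(`eq_zero_of_isAxisymmetric` of `HomogeneousEulerAxisymmetricWindow.lean` minus its hypothesis on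
the pressure). [cite: Shvydkoy2018, Prop. 5.1] -/
theorem eq_zero_of_isAxisymmetric_velocity_of_one_lt (h : IsHomogeneousSteadyEuler α V P)
    (hax : IsAxisymmetric V) (h1 : 1 < α) (h2 : α < 2)
    ⦃x : EuclideanSpace ℝ (Fin 3)⦄ (hx : x ≠ 0) : V x = 0 :=
  h.eq_zero_of_isAxisymmetric hax (h.isAxisymmetricScalar_pressure hax (by linarith)) h1 h2 hx

end IsHomogeneousSteadyEuler

end Literature.Analysis.FluidPDE
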